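import Mathlib
import Summits.Ventures.PercRepro2.SwOutCrossJunctionThmG
import Summits.Ventures.PercRepro2.SwOutCrossJunctionSw

/-!
# Rows 2′SW-ALL and (SW) on every graph with a junction whose dropped vertices form ANY cross
graph with the inequality — in particular TWO connected components (blind cell PercRepro2,
night-4 g25, 2026-08-28; proofs/NIGHT4-G25.md §4)

The corollaries of `rigidOK_of_crossJunction'` (`reducible_of_crossJunction'`,
`swAll_of_crossJunction'`, `sw_of_crossJunction'`), and their instances for a cross graph
`G₁ ⊕g G₂` with both parts connected (`IneqAll` from `ineqM_fibKEESum₂`, the joint order):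
**`rigidOK_of_crossJunction₂`**, **`swAll_of_crossJunction₂`**, **`sw_of_crossJunction₂`** —
THEOREM A_cross FOR TWO CONNECTED DROPPED COMPONENTS AT ONE JUNCTION: rows 2′SW-ALL and (SW) on
every graph in which some vertex `u ≠ l, h` has every neighbour `h`-adjacent or a dropped vertex
of one of two connected cross-edge components.
-/

namespace Summit.Ventures.PercRepro2

namespace CrossArm

open Hull LocRows

universe uV

variable {V : Type uV} {E : Type*} [Fintype E] [DecidableEq E]

open scoped Classical

section Any

variable {ends : E → Sym2 V} {X : Type*} [Fintype X] {U : Set V} {l h o u : V} {p : X → V}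
  {G : SimpleGraph X} [DecidableRel G.Adj]

/-- A region with a cross junction whose cross graph has the inequality is a base region of the
series reduction. -/
theorem CrossJunction.reducible_of_crossJunction' (hj : CrossJunction ends U h u p G o) (hl : l ∉ U)
    (hineq : IneqAll G V) : Reducible l h o ends U :=
  Reducible.base ends U fun ξ => hj.rigidOK_of_crossJunction' (ξ := ξ) hl hineq

/-- **Row 2′SW-ALL on every graph with a cross junction whose cross graph has the inequality.** -/
theorem swAll_of_crossJunction' (hlh : l ≠ h) (hj : CrossJunction ends ({l}ᶜ) h u p G o)
    (hineq : IneqAll G V) : SwAll ends l h o :=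
  swAll_of_reducible l h o hlh (hj.reducible_of_crossJunction' (by simp) hineq)

/-- **Row (SW) on every graph with a cross junction whose cross graph has the inequality.** -/
theorem sw_of_crossJunction' (hlh : l ≠ h) (hj : CrossJunction ends ({l}ᶜ) h u p G o)
    (hineq : IneqAll G V) : Sw ends l h o :=
  sw_of_swAll ends (swAll_of_crossJunction' hlh hj hineq)

end Any

section Two

variable {ends : E → Sym2 V} {X₁ X₂ : Type*} [Fintype X₁] [DecidableEq X₁] [Nonempty X₁]
  [Fintype X₂] [DecidableEq X₂] [Nonempty X₂] {G₁ : SimpleGraph X₁} {G₂ : SimpleGraph X₂}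
  [DecidableRel G₁.Adj] [DecidableRel G₂.Adj] (hG₁ : G₁.Connected) (hG₂ : G₂.Connected)
  {U : Set V} {l h o u : V} {p : X₁ ⊕ X₂ → V}
include hG₁ hG₂

/-- The record of two connected components has the inequality over every u-arm type. -/
theorem ineqAll_sum : IneqAll (G₁ ⊕g G₂) V := by
  intro S _ _ _ _ _
  convert ineqM_fibKEESum₂ G₁ G₂ hG₁ hG₂ (ι := {P // P ∈ S}) using 2

/-- **THEOREM A_cross FOR TWO CONNECTED DROPPED COMPONENTS AT ONE JUNCTION**: the rigid
inequality on every class, for every outside colouring. -/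
theorem CrossJunction.rigidOK_of_crossJunction₂ (hj : CrossJunction ends U h u p (G₁ ⊕g G₂) o)
    (hl : l ∉ U) (ξ : Config E) : RigidOK ends l h o U ξ :=
  haveI : DecidableRel (G₁ ⊕g G₂).Adj := Classical.decRel _
  hj.rigidOK_of_crossJunction' hl (ineqAll_sum hG₁ hG₂)

/-- **Row 2′SW-ALL on every graph with a junction whose dropped vertices form two connected
cross-edge components.** -/
theorem swAll_of_crossJunction₂ (hlh : l ≠ h) (hj : CrossJunction ends ({l}ᶜ) h u p (G₁ ⊕g G₂) o) :
    SwAll ends l h o :=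
  haveI : DecidableRel (G₁ ⊕g G₂).Adj := Classical.decRel _
  swAll_of_crossJunction' hlh hj (ineqAll_sum hG₁ hG₂)

/-- **Row (SW) on every graph with a junction whose dropped vertices form two connected
cross-edge components.** -/
theorem sw_of_crossJunction₂ (hlh : l ≠ h) (hj : CrossJunction ends ({l}ᶜ) h u p (G₁ ⊕g G₂) o) :
    Sw ends l h o :=
  haveI : DecidableRel (G₁ ⊕g G₂).Adj := Classical.decRel _
  sw_of_crossJunction' hlh hj (ineqAll_sum hG₁ hG₂)

end Two

end CrossArm

end Summit.Ventures.PercRepro2
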